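import Summits.QuantumFields.BalabanUV.T4Continuum.Support.AveragingDeficitMultiLevelPrep
import HarnessLib

/-!
# NE7RadIterUniform — THE ITERATED PROP-1 RADIUS OF A CLASS CONFIGURATION IS UNIFORMLY SMALL AT EVERY LEVEL:
# `radIter d L m (ε·L^{−2(t+m)}) ≤ 2ε·L^{−2t}` and `LevelSmall d L j (ε·L^{−2(j+1)})` for `ε ≤ ε₁(d, L)`, EVERY `j`, `m`, `t`

Lineage `b2b-balaban-t4-ne7-p1` (CRUX PROVER NE7 #1 = OWNER of BINDER row NE7), generation 116 — brick 6a of ROAD-G116 §8.  The tree's B7 Prop. 1 radius (✓ `AveragingDeficitTwoLevelPrep.prop1Radius`: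
`a ↦ L²a + 226(8(d+1)(d+4)L²a)² = L²a + D a²`) has the SHARP leading term `L²a`, so along the tower started from the class radius `ε·L^{−2(j+1)}` the radii stay within a factor `2`
of the scale-covariant values `ε·L^{−2(j+1−m)}` (the quadratic corrections sum geometrically) — whereas the crude closed-form test ✓ `levelSmall_of_pow` (`(2L²)^j`) loses `2^j`.  Pure real
analysis ([folklore]; defs `radD`, `radBnd`; 0 sorry): `prop1Radius_le_of_le` (one step: `x ≤ c·q^{k+1} ⇒ prop1Radius x ≤ c(1 + D c q^{k+2})·q^k`, `q = L^{−2}`), `radIter_mono`,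
`radIter_le_radBnd` (the iterate is below the recursively defined constant `radBnd`), **`radBnd_le`** (reciprocal invariant: `radBnd m c ≤ c∕(1 − cDq^{t+2}Σ_{i<m} qⁱ)`), **`radIter_le_two_mul`**
(`radIter d L m (c·q^{t+m}) ≤ 2c·q^t` when `4·c·D·q² ≤ 1`, `L ≥ 2`), and **`levelSmall_of_class_radius`** (`LevelSmall d L j (ε·q^{j+1})` when moreover `twoLevelSmall d L·2ε·q ≤ 1`).
HONEST FRAMING: bookkeeping of OUR radii (B7 Prop. 1 constants as typed in the tree); nothing of Bałaban's asserted; NOT NE7 as a spine node; spine 0∕9; NOT infinite volume, NOT mass gap,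
NOT BetaPertH, NOT Clay.
-/

set_option autoImplicit false

open scoped BigOperators
open Finset

namespace Summit.QuantumFields.BalabanUV.T4Continuum.NE7RadIterUniform

open AveragingDeficitTwoLevelPrep (prop1Radius twoLevelSmall)
open AveragingDeficitMultiLevelPrep (radIter LevelSmall prop1Radius_mono prop1Radius_nonneg)

noncomputable section

variable {d : ℕ}

/-- The quadratic coefficient of the Prop-1 radius: `prop1Radius d L a = L²a + radD d L · a²`. [folklore] -/
def radD (d L : ℕ) : ℝ := 226 * (8 * ((d : ℝ) + 1) * ((d : ℝ) + 4) * (L : ℝ) ^ 2) ^ 2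

/-- `prop1Radius` as a quadratic polynomial. [folklore] -/
theorem prop1Radius_eq (L : ℕ) (a : ℝ) : prop1Radius d L a = (L : ℝ) ^ 2 * a + radD d L * a ^ 2 := by
  unfold prop1Radius radD; ring

/-- `radD ≥ 0`. [folklore] -/
theorem radD_nonneg (L : ℕ) : 0 ≤ radD d L := by unfold radD; positivity

/-- `radIter` is monotone on `[0, ∞)`. [folklore] -/
theorem radIter_mono (L : ℕ) : ∀ (m : ℕ) {x y : ℝ}, 0 ≤ x → x ≤ y → radIter d L m x ≤ radIter d L m y
  | 0, _, _, _, hxy => hxy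
  | m + 1, _, _, hx, hxy => radIter_mono L m (prop1Radius_nonneg hx) (prop1Radius_mono hx hxy)

/-- `radIter` is nonnegative on `[0, ∞)`. [folklore] -/
theorem radIter_nonneg (L : ℕ) : ∀ (m : ℕ) {x : ℝ}, 0 ≤ x → 0 ≤ radIter d L m x
  | 0, _, hx => hx
  | m + 1, _, hx => radIter_nonneg L m (prop1Radius_nonneg hx)

/-- **One step**: `0 ≤ x ≤ c·q^{k+1}` (`q = (L²)⁻¹`, `L ≥ 1`) ⇒ `prop1Radius x ≤ c·(1 + D·c·q^{k+2})·q^k`. [folklore] -/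
theorem prop1Radius_le_of_le {L : ℕ} (hL : 1 ≤ L) {c x : ℝ} (hx : 0 ≤ x) (k : ℕ) (hxc : x ≤ c * (((L : ℝ) ^ 2)⁻¹) ^ (k + 1)) :
    prop1Radius d L x ≤ c * (1 + radD d L * c * (((L : ℝ) ^ 2)⁻¹) ^ (k + 2)) * (((L : ℝ) ^ 2)⁻¹) ^ k := by
  set q : ℝ := ((L : ℝ) ^ 2)⁻¹ with hq
  have hL2 : (0 : ℝ) < (L : ℝ) ^ 2 := by positivity
  have hq0 : 0 ≤ q := by positivity
  have hLq : (L : ℝ) ^ 2 * q = 1 := by rw [hq, mul_inv_cancel₀ hL2.ne']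
  have hD := radD_nonneg (d := d) L
  rw [prop1Radius_eq]
  have h1 : (L : ℝ) ^ 2 * x ≤ c * q ^ k := by
    calc (L : ℝ) ^ 2 * x ≤ (L : ℝ) ^ 2 * (c * q ^ (k + 1)) := mul_le_mul_of_nonneg_left hxc hL2.le
      _ = c * q ^ k * ((L : ℝ) ^ 2 * q) := by ring
      _ = c * q ^ k := by rw [hLq, mul_one]
  have h2 : radD d L * x ^ 2 ≤ radD d L * (c * q ^ (k + 1)) ^ 2 := by
    exact mul_le_mul_of_nonneg_left (pow_le_pow_left₀ hx hxc 2) hD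
  have h3 : radD d L * (c * q ^ (k + 1)) ^ 2 = c * (radD d L * c * q ^ (k + 2)) * q ^ k := by ring
  nlinarith [h1, h2, h3]

/-- The bounding constants along the tower: `radBnd 0 c = c`, `radBnd (m+1) c = radBnd m (c(1 + D c q^{t+m+2}))`. [folklore] -/
def radBnd (d L t : ℕ) : ℕ → ℝ → ℝ
  | 0, c => c
  | m + 1, c => radBnd d L t m (c * (1 + radD d L * c * (((L : ℝ) ^ 2)⁻¹) ^ (t + m + 2)))

/-- `radBnd` is nonnegative and at least `c` for `c ≥ 0`. [folklore] -/
theorem le_radBnd {L : ℕ} (t : ℕ) : ∀ (m : ℕ) {c : ℝ}, 0 ≤ c → c ≤ radBnd d L t m c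
  | 0, _, _ => le_rfl
  | m + 1, c, hc => by
      have hD := radD_nonneg (d := d) L
      have h1 : c ≤ c * (1 + radD d L * c * (((L : ℝ) ^ 2)⁻¹) ^ (t + m + 2)) := by
        have : 0 ≤ radD d L * c * (((L : ℝ) ^ 2)⁻¹) ^ (t + m + 2) := by positivity
        nlinarith
      exact h1.trans (le_radBnd t m (hc.trans h1))

/-- **THE ITERATE IS BELOW THE BOUNDING CONSTANT**: `0 ≤ x ≤ c·q^{t+m}` ⇒ `radIter d L m x ≤ radBnd m c · q^t` (`L ≥ 1`, `c ≥ 0`). [folklore] -/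
theorem radIter_le_radBnd {L : ℕ} (hL : 1 ≤ L) (t : ℕ) :
    ∀ (m : ℕ) {c x : ℝ}, 0 ≤ c → 0 ≤ x → x ≤ c * (((L : ℝ) ^ 2)⁻¹) ^ (t + m) → radIter d L m x ≤ radBnd d L t m c * (((L : ℝ) ^ 2)⁻¹) ^ t
  | 0, _, _, _, _, hxc => by simpa [radIter, radBnd] using hxc
  | m + 1, c, x, hc, hx, hxc => by
      have hD := radD_nonneg (d := d) L
      have hstep := prop1Radius_le_of_le (d := d) hL hx (t + m) (by rw [show t + m + 1 = t + (m + 1) by ring]; exact hxc)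
      have hc' : 0 ≤ c * (1 + radD d L * c * (((L : ℝ) ^ 2)⁻¹) ^ (t + m + 2)) := by positivity
      exact radIter_le_radBnd hL t m hc' (prop1Radius_nonneg hx) hstep

/-- **THE RECIPROCAL INVARIANT**: for `c > 0` with `s := c·D·q^{t+2}·Σ_{i<m} qⁱ < 1`, `radBnd m c ≤ c∕(1 − s)`. [folklore] -/
theorem radBnd_le {L : ℕ} (hL : 1 ≤ L) (t : ℕ) :
    ∀ (m : ℕ) {c : ℝ}, 0 < c →
      c * radD d L * (((L : ℝ) ^ 2)⁻¹) ^ (t + 2) * (∑ i ∈ range m, (((L : ℝ) ^ 2)⁻¹) ^ i) < 1 →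
        radBnd d L t m c ≤ c / (1 - c * radD d L * (((L : ℝ) ^ 2)⁻¹) ^ (t + 2) * (∑ i ∈ range m, (((L : ℝ) ^ 2)⁻¹) ^ i))
  | 0, c, hc, _ => by simp [radBnd]
  | m + 1, c, hc, hs => by
      set q : ℝ := ((L : ℝ) ^ 2)⁻¹ with hq
      set D : ℝ := radD d L with hDdef
      have hD : 0 ≤ D := radD_nonneg (d := d) L
      have hq0 : 0 ≤ q := by positivity
      set ρ : ℝ := q ^ (t + m + 2) with hρ
      set σ : ℝ := ∑ i ∈ range m, q ^ i with hσ
      have hσ0 : 0 ≤ σ := Finset.sum_nonneg fun i _ => by positivity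
      -- the new constant
      set c₁ : ℝ := c * (1 + D * c * ρ) with hc₁
      have hδ0 : 0 ≤ D * c * ρ := by positivity
      have hc₁pos : 0 < c₁ := by positivity
      -- the sums: `Σ_{i<m+1} q^i = σ + q^m` and `q^{t+2}·q^m = ρ`
      have hsum : ∑ i ∈ range (m + 1), q ^ i = σ + q ^ m := by rw [Finset.sum_range_succ]
      have hρeq : q ^ (t + 2) * q ^ m = ρ := by rw [hρ, ← pow_add]; ring_nf
      have hS : c * D * q ^ (t + 2) * (σ + q ^ m) = c * D * q ^ (t + 2) * σ + c * D * ρ := by rw [← hρeq]; ring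
      rw [hsum] at hs
      rw [hsum, show radBnd d L t (m + 1) c = radBnd d L t m c₁ by rfl]
      -- `1/c₁ ≥ 1/c − Dρ`: `c₁ ≤ c/(1 − cDρ)`
      have hcDρ : c * D * ρ < 1 := by nlinarith [hS, hs, mul_nonneg (mul_nonneg (mul_nonneg hc.le hD) (pow_nonneg hq0 (t + 2))) hσ0]
      have hkey : c₁ * (1 - c * D * ρ) ≤ c := by
        have : c₁ * (1 - c * D * ρ) = c * (1 - (D * c * ρ) ^ 2) := by rw [hc₁]; ring
        rw [this]; nlinarith [sq_nonneg (D * c * ρ)]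
      -- the hypothesis for the induction at `c₁`
      have hs₁ : c₁ * D * q ^ (t + 2) * σ < 1 := by
        -- `c₁ D q^{t+2} σ ≤ c D q^{t+2} σ / (1 − cDρ) < 1`
        have h1 : c₁ * D * q ^ (t + 2) * σ * (1 - c * D * ρ) ≤ c * D * q ^ (t + 2) * σ := by
          have := mul_le_mul_of_nonneg_right hkey (by positivity : 0 ≤ D * q ^ (t + 2) * σ)
          nlinarith [this]
        have h2 : c * D * q ^ (t + 2) * σ < 1 - c * D * ρ := by linarith [hS, hs]
        have hpos : 0 < 1 - c * D * ρ := by linarith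
        have h3 : c₁ * D * q ^ (t + 2) * σ * (1 - c * D * ρ) < 1 * (1 - c * D * ρ) := by linarith
        exact lt_of_mul_lt_mul_right h3 hpos.le
      have ih := radBnd_le hL t m hc₁pos hs₁
      refine ih.trans ?_
      -- `c₁/(1 − c₁Dq^{t+2}σ) ≤ c/(1 − cDq^{t+2}(σ + q^m))`
      have hden₁ : 0 < 1 - c₁ * D * q ^ (t + 2) * σ := by linarith
      have hden : 0 < 1 - c * D * q ^ (t + 2) * (σ + q ^ m) := by linarith
      rw [div_le_div_iff₀ hden₁ hden]
      -- cross-multiplied: `c₁ (1 − cDq^{t+2}σ − cDρ) ≤ c (1 − c₁ D q^{t+2} σ)`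
      rw [hS]
      nlinarith [hkey, mul_nonneg (mul_nonneg (mul_nonneg hc₁pos.le hD) (pow_nonneg hq0 (t + 2))) hσ0,
        mul_nonneg (mul_nonneg (mul_nonneg hc.le hD) (pow_nonneg hq0 (t + 2))) hσ0]

/-- The geometric sum: `Σ_{i<m} qⁱ ≤ 2` for `0 ≤ q ≤ 1/2`. [folklore] -/
theorem geom_sum_le_two {q : ℝ} (hq0 : 0 ≤ q) (hq : q ≤ 1 / 2) (m : ℕ) : ∑ i ∈ range m, q ^ i ≤ 2 := by
  have hq1 : q < 1 := by linarith
  have h := geom_sum_Ico_le_of_lt_one hq0 hq1 (m := 0) (n := m)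
  simp only [pow_zero] at h
  have hr : range m = Ico 0 m := by rw [Finset.range_eq_Ico]
  rw [hr]
  refine h.trans ?_
  rw [div_le_iff₀ (by linarith)]
  linarith

/-- **UNIFORM RADIUS ALONG THE TOWER**: for `L ≥ 2`, `0 ≤ c` with `4·c·radD d L·q² ≤ 1` (`q = L^{−2}`) and `0 ≤ x ≤ c·q^{t+m}`: `radIter d L m x ≤ 2c·q^t`. [folklore] -/
theorem radIter_le_two_mul {L : ℕ} (hL : 2 ≤ L) {c : ℝ} (hc : 0 ≤ c) (hcD : 4 * c * radD d L * (((L : ℝ) ^ 2)⁻¹) ^ 2 ≤ 1)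
    (t m : ℕ) {x : ℝ} (hx : 0 ≤ x) (hxc : x ≤ c * (((L : ℝ) ^ 2)⁻¹) ^ (t + m)) :
    radIter d L m x ≤ 2 * c * (((L : ℝ) ^ 2)⁻¹) ^ t := by
  have hL1 : 1 ≤ L := by omega
  set q : ℝ := ((L : ℝ) ^ 2)⁻¹ with hq
  have hL2 : (4 : ℝ) ≤ (L : ℝ) ^ 2 := by
    have : (2 : ℝ) ≤ L := by exact_mod_cast hL
    nlinarith
  have hq0 : 0 ≤ q := by positivity
  have hqhalf : q ≤ 1 / 2 := by
    rw [hq, inv_le_comm₀ (by positivity) (by norm_num)]; linarith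
  have hq1 : q ≤ 1 := by linarith
  have hD := radD_nonneg (d := d) L
  have hB := radIter_le_radBnd (d := d) hL1 t m hc hx hxc
  refine hB.trans ?_
  have hqt : 0 ≤ q ^ t := pow_nonneg hq0 t
  suffices h : radBnd d L t m c ≤ 2 * c from by nlinarith [h]
  rcases hc.eq_or_lt with h0 | hcpos
  · -- `c = 0`
    subst h0
    have : ∀ m', radBnd d L t m' (0 : ℝ) = 0 := by
      intro m'
      induction m' with
      | zero => rfl
      | succ k ih => show radBnd d L t k (0 * _) = 0; rw [zero_mul]; exact ih
    rw [this]; linarith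
  · have hσ := geom_sum_le_two hq0 hqhalf m
    have hσ0 : 0 ≤ ∑ i ∈ range m, q ^ i := Finset.sum_nonneg fun i _ => by positivity
    have hqt2 : q ^ (t + 2) ≤ q ^ 2 := pow_le_pow_of_le_one hq0 hq1 (by omega)
    have hs : c * radD d L * q ^ (t + 2) * (∑ i ∈ range m, q ^ i) ≤ 1 / 2 := by
      calc c * radD d L * q ^ (t + 2) * (∑ i ∈ range m, q ^ i) ≤ c * radD d L * q ^ 2 * 2 := by
            gcongr
        _ ≤ 1 / 2 := by nlinarith [hcD]
    have h := radBnd_le (d := d) hL1 t m hcpos (by linarith)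
    refine h.trans ?_
    rw [div_le_iff₀ (by linarith)]
    nlinarith [hs]

/-- `LevelSmall` from bounds on all the iterated radii. [folklore] -/
theorem levelSmall_of_radIter_le {L : ℕ} : ∀ (j : ℕ) {x : ℝ}, (∀ i ≤ j, twoLevelSmall d L * radIter d L i x ≤ 1) → LevelSmall d L j x
  | 0, _, h => by simpa [LevelSmall, radIter] using h 0 le_rfl
  | j + 1, _, h => by
      refine ⟨by simpa [radIter] using h 0 (Nat.zero_le _), levelSmall_of_radIter_le j fun i hi => ?_⟩
      have := h (i + 1) (by omega)
      simpa [radIter] using this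

/-- **MULTI-LEVEL SMALLNESS OF THE CLASS RADIUS**: for `L ≥ 2`, `0 ≤ ε`, `4·ε·radD d L·L^{−4} ≤ 1` and `twoLevelSmall d L · 2ε · L^{−2} ≤ 1`: `LevelSmall d L j (ε·L^{−2(j+1)})` for EVERY `j`,
and `radIter d L m (ε·L^{−2(j+1)}) ≤ 2ε·L^{−2(j+1−m)}` for `m ≤ j + 1`. [folklore] -/
theorem levelSmall_of_class_radius {L : ℕ} (hL : 2 ≤ L) {ε : ℝ} (hε : 0 ≤ ε) (hεD : 4 * ε * radD d L * (((L : ℝ) ^ 2)⁻¹) ^ 2 ≤ 1)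
    (hεT : twoLevelSmall d L * (2 * ε * ((L : ℝ) ^ 2)⁻¹) ≤ 1) (j : ℕ) :
    LevelSmall d L j (ε * (((L : ℝ) ^ 2)⁻¹) ^ (j + 1)) ∧
      ∀ m ≤ j + 1, radIter d L m (ε * (((L : ℝ) ^ 2)⁻¹) ^ (j + 1)) ≤ 2 * ε * (((L : ℝ) ^ 2)⁻¹) ^ (j + 1 - m) := by
  set q : ℝ := ((L : ℝ) ^ 2)⁻¹ with hq
  have hq0 : 0 ≤ q := by positivity
  have hq1 : q ≤ 1 := by
    rw [hq]; exact inv_le_one_of_one_le₀ (one_le_pow₀ (by exact_mod_cast (show 1 ≤ L by omega)))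
  have hx0 : 0 ≤ ε * q ^ (j + 1) := by positivity
  have hrad : ∀ m ≤ j + 1, radIter d L m (ε * q ^ (j + 1)) ≤ 2 * ε * q ^ (j + 1 - m) := by
    intro m hm
    have := radIter_le_two_mul (d := d) hL hε hεD (j + 1 - m) m hx0 (by rw [Nat.sub_add_cancel hm])
    exact this
  refine ⟨levelSmall_of_radIter_le j fun i hi => ?_, hrad⟩
  have h1 := hrad i (by omega)
  have h2 : q ^ (j + 1 - i) ≤ q := by
    calc q ^ (j + 1 - i) ≤ q ^ 1 := pow_le_pow_of_le_one hq0 hq1 (by omega)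
      _ = q := pow_one q
  have hT : 0 ≤ twoLevelSmall d L := by unfold twoLevelSmall; positivity
  calc twoLevelSmall d L * radIter d L i (ε * q ^ (j + 1)) ≤ twoLevelSmall d L * (2 * ε * q) := by
        refine mul_le_mul_of_nonneg_left (h1.trans ?_) hT
        nlinarith [h2]
    _ ≤ 1 := hεT

end

end Summit.QuantumFields.BalabanUV.T4Continuum.NE7RadIterUniform
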